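import Mathlib
import HarnessLib

/-!
# Route `KLProgramme` — crux K3, gen-5 ENGINE child (stmt-HubbardSuperconductivity-19918 `KLRegimeEngineV14`): PERIODIZATION of a planar function that
# vanishes near the boundary of the square — continuous, doubly `2π`-periodic, Lipschitz (cell gate-hubbard-kl, seat hubbard-kl-k3c2-p2)

WHY.  The lattice step `klfl_matsubara_latticeAverage_norm_le(_scale)` (…LatticeMatsubaraBubble) wants, per Matsubara frequency, a doubly
`2π`-periodic, continuous, `K`-Lipschitz planar function `F` agreeing on the closed square with the planar integrand `h` of the `ℝ × ℝ` bubble estimates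
(`klfb_*`), `h = 0` off the square.  The natural weights of the expansion (sector functions of the CENTRED momentum's polar angle) are smooth on each
open cell but not across cell boundaries; the zone margin makes the integrand vanish within `zm` of the boundary.  This module supplies the generic
device: for `g : ℝ × ℝ → E` with `g(p) = 0` whenever `|p₁| ≥ π − zm` or `|p₂| ≥ π − zm` (`0 < zm`), bounded by `M_g` and `L_g`-Lipschitz on the closed
square, the periodization `g_per(x, y) = g(wrap x, wrap y)` (`wrap = toIcoMod 2π (−π)`, values in `[−π, π)`) is doubly `2π`-periodic, equals `g` on the
closed square, is bounded by `M_g`, CONTINUOUS, and `(L_g + 2M_g/zm)`-Lipschitz on `ℝ²` (`klfl_periodize_*`).  Pure analysis.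
-/

noncomputable section

namespace Summit.HubbardSuperconductivity.HubbardSuperconductivity.Theorems.KLRegimeSplit

set_option linter.dupNamespace false -- summit = problem name (single-conjunct summit), D-0017

open Real Set Filter Topology

variable {E : Type*} [NormedAddCommGroup E]

/-! ## §1 The wrap `ℝ → [−π, π)` -/

/-- `wrap x ∈ [−π, π)`, `wrap x ≡ x (mod 2π)`. -/
def klfl_wrap (x : ℝ) : ℝ := toIcoMod Real.two_pi_pos (-π) x

/-- `wrap x ∈ [−π, π)`. -/
theorem klfl_wrap_mem (x : ℝ) : klfl_wrap x ∈ Ico (-π) π := by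
  have h := toIcoMod_mem_Ico Real.two_pi_pos (-π) x
  rw [show -π + 2 * π = π by ring] at h
  exact h

/-- `wrap (x + 2π) = wrap x`. -/
theorem klfl_wrap_add_two_pi (x : ℝ) : klfl_wrap (x + 2 * π) = klfl_wrap x :=
  toIcoMod_add_right Real.two_pi_pos (-π) x

/-- On `[−π, π)` the wrap is the identity. -/
theorem klfl_wrap_eq_self {x : ℝ} (hx : x ∈ Ico (-π) π) : klfl_wrap x = x := by
  rw [klfl_wrap, toIcoMod_eq_self]
  rwa [show -π + 2 * π = π by ring]

/-- `wrap π = −π`. -/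
theorem klfl_wrap_pi : klfl_wrap π = -π := by
  have h : klfl_wrap π = klfl_wrap (-π + 2 * π) := by congr 1; ring
  rw [h, klfl_wrap_add_two_pi]
  exact klfl_wrap_eq_self ⟨le_rfl, by linarith [Real.pi_pos]⟩

/-- `wrap x − x` is an integer multiple of `2π`. -/
theorem klfl_wrap_sub_self (x : ℝ) : ∃ z : ℤ, klfl_wrap x - x = z * (2 * π) := by
  refine ⟨-toIcoDiv Real.two_pi_pos (-π) x, ?_⟩
  rw [klfl_wrap, toIcoMod_sub_self, zsmul_eq_mul, Int.cast_neg, neg_mul]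

/-- **The dichotomy.**  For `|x − y| < zm ≤ π`: either `wrap x − wrap y = x − y`, or both wraps are within `zm` of `±π`
(`π − zm ≤ |wrap x|` and `π − zm ≤ |wrap y|`). -/
theorem klfl_wrap_dichotomy {zm : ℝ} (hzm : zm ≤ π) {x y : ℝ} (hxy : |x - y| < zm) :
    klfl_wrap x - klfl_wrap y = x - y ∨ (π - zm ≤ |klfl_wrap x| ∧ π - zm ≤ |klfl_wrap y|) := by
  obtain ⟨zx, hzx⟩ := klfl_wrap_sub_self x
  obtain ⟨zy, hzy⟩ := klfl_wrap_sub_self y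
  have hx := klfl_wrap_mem x
  have hy := klfl_wrap_mem y
  have hdiff : klfl_wrap x - klfl_wrap y = (x - y) + (zx - zy : ℤ) * (2 * π) := by push_cast; linarith
  by_cases hk : zx - zy = 0
  · left; rw [hdiff, hk]; push_cast; ring
  · right
    obtain ⟨hlo, hhi⟩ := abs_lt.mp hxy
    obtain ⟨hx1, hx2⟩ := hx
    obtain ⟨hy1, hy2⟩ := hy
    rcases lt_or_gt_of_ne hk with hneg | hpos
    · have hk' : ((zx - zy : ℤ) : ℝ) ≤ -1 := by exact_mod_cast Int.le_sub_one_of_lt hneg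
      have h1 : klfl_wrap x - klfl_wrap y ≤ (x - y) - 2 * π := by
        rw [hdiff]; nlinarith [Real.pi_pos]
      constructor
      · have : π - zm ≤ -klfl_wrap x := by linarith
        exact this.trans (neg_le_abs _)
      · have : π - zm ≤ klfl_wrap y := by linarith
        exact this.trans (le_abs_self _)
    · have hk' : (1 : ℝ) ≤ ((zx - zy : ℤ) : ℝ) := by exact_mod_cast hpos
      have h1 : (x - y) + 2 * π ≤ klfl_wrap x - klfl_wrap y := by
        rw [hdiff]; nlinarith [Real.pi_pos]
      constructor
      · have : π - zm ≤ klfl_wrap x := by linarith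
        exact this.trans (le_abs_self _)
      · have : π - zm ≤ -klfl_wrap y := by linarith
        exact this.trans (neg_le_abs _)

/-- Near a jump point the wrap is within `|t|` of `±π`: if `x ≡ −π (mod 2π)` and `|t| < π` then `π − |t| ≤ |wrap (x + t)|`. -/
theorem klfl_abs_wrap_ge_of_modEq {x t : ℝ} (hx : ∃ z : ℤ, x = -π + z * (2 * π)) (ht : |t| < π) : π - |t| ≤ |klfl_wrap (x + t)| := by
  obtain ⟨z, rfl⟩ := hx
  have hper : klfl_wrap (-π + z * (2 * π) + t) = klfl_wrap (-π + t) := by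
    rw [show -π + z * (2 * π) + t = (-π + t) + z • (2 * π) by rw [zsmul_eq_mul]; ring]
    exact toIcoMod_add_zsmul Real.two_pi_pos (-π) (-π + t) z
  rw [hper]
  have habs := abs_lt.mp ht
  rcases le_or_gt 0 t with h0 | h0
  · rw [klfl_wrap_eq_self ⟨by linarith, by linarith⟩, abs_of_nonpos (show -π + t ≤ 0 by linarith), abs_of_nonneg h0]
    linarith
  · have heq : klfl_wrap (-π + t) = π + t := by
      have : -π + t = (π + t) + (-1 : ℤ) • (2 * π) := by rw [zsmul_eq_mul]; push_cast; ring
      rw [klfl_wrap, this, toIcoMod_add_zsmul]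
      exact klfl_wrap_eq_self ⟨by linarith, by linarith⟩
    rw [heq, abs_of_pos (show 0 < π + t by linarith), abs_of_neg h0]
    linarith

/-! ## §2 The periodization -/

/-- **The periodization** `g_per(x, y) = g(wrap x, wrap y)`. -/
def klfl_periodize (g : ℝ × ℝ → E) (p : ℝ × ℝ) : E := g (klfl_wrap p.1, klfl_wrap p.2)

omit [NormedAddCommGroup E] in
/-- Doubly `2π`-periodic. -/
theorem klfl_periodize_add_fst (g : ℝ × ℝ → E) (x y : ℝ) : klfl_periodize g (x + 2 * π, y) = klfl_periodize g (x, y) := by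
  simp only [klfl_periodize, klfl_wrap_add_two_pi]

omit [NormedAddCommGroup E] in
/-- Doubly `2π`-periodic. -/
theorem klfl_periodize_add_snd (g : ℝ × ℝ → E) (x y : ℝ) : klfl_periodize g (x, y + 2 * π) = klfl_periodize g (x, y) := by
  simp only [klfl_periodize, klfl_wrap_add_two_pi]

/-- Bounded by the bound of `g`. -/
theorem klfl_periodize_norm_le {g : ℝ × ℝ → E} {Mg : ℝ} (hbd : ∀ p, ‖g p‖ ≤ Mg) (p : ℝ × ℝ) : ‖klfl_periodize g p‖ ≤ Mg := hbd _

section BoundaryVanishing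

variable {g : ℝ × ℝ → E} {zm : ℝ} (hzm : 0 < zm) (hg0 : ∀ p : ℝ × ℝ, (π - zm ≤ |p.1| ∨ π - zm ≤ |p.2|) → g p = 0)
include hzm hg0

/-- **On the closed square the periodization IS `g`** (on the right/top edges both vanish). -/
theorem klfl_periodize_eq_of_mem {p : ℝ × ℝ} (hp : p ∈ Icc (-π) π ×ˢ Icc (-π) π) : klfl_periodize g p = g p := by
  obtain ⟨⟨h1a, h1b⟩, ⟨h2a, h2b⟩⟩ := hp
  by_cases hx : p.1 = π
  · have hgp : g p = 0 := hg0 p (Or.inl (by rw [hx, abs_of_pos Real.pi_pos]; linarith))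
    have hw : g (klfl_wrap p.1, klfl_wrap p.2) = 0 := hg0 _ (Or.inl (by
      simp only [hx, klfl_wrap_pi, abs_neg, abs_of_pos Real.pi_pos]; linarith))
    rw [klfl_periodize, hw, hgp]
  by_cases hy : p.2 = π
  · have hgp : g p = 0 := hg0 p (Or.inr (by rw [hy, abs_of_pos Real.pi_pos]; linarith))
    have hw : g (klfl_wrap p.1, klfl_wrap p.2) = 0 := hg0 _ (Or.inr (by
      simp only [hy, klfl_wrap_pi, abs_neg, abs_of_pos Real.pi_pos]; linarith))
    rw [klfl_periodize, hw, hgp]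
  rw [klfl_periodize, klfl_wrap_eq_self ⟨h1a, lt_of_le_of_ne h1b hx⟩, klfl_wrap_eq_self ⟨h2a, lt_of_le_of_ne h2b hy⟩]

/-- **Lipschitz on the plane** from Lipschitz on the closed square: constant `L_g + 2M_g/zm` (sup metric). -/
theorem klfl_periodize_lipschitz {Lg Mg : ℝ} (hLg : 0 ≤ Lg) (hbd : ∀ p, ‖g p‖ ≤ Mg)
    (hlip : ∀ p ∈ Icc (-π) π ×ˢ Icc (-π) π, ∀ q ∈ Icc (-π) π ×ˢ Icc (-π) π, ‖g p - g q‖ ≤ Lg * dist p q) (hzmπ : zm ≤ π)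
    (p q : ℝ × ℝ) : ‖klfl_periodize g p - klfl_periodize g q‖ ≤ (Lg + 2 * Mg / zm) * dist p q := by
  have hMg : 0 ≤ Mg := (norm_nonneg _).trans (hbd 0)
  have hd0 : 0 ≤ dist p q := dist_nonneg
  by_cases hfar : zm ≤ dist p q
  · -- far apart: the crude bound
    calc ‖klfl_periodize g p - klfl_periodize g q‖ ≤ ‖klfl_periodize g p‖ + ‖klfl_periodize g q‖ := norm_sub_le _ _
      _ ≤ Mg + Mg := add_le_add (hbd _) (hbd _)
      _ = (2 * Mg / zm) * zm := by field_simp; ring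
      _ ≤ (2 * Mg / zm) * dist p q := mul_le_mul_of_nonneg_left hfar (by positivity)
      _ ≤ (Lg + 2 * Mg / zm) * dist p q := by nlinarith
  · push Not at hfar
    have h1 : |p.1 - q.1| < zm := lt_of_le_of_lt (by rw [← Real.dist_eq, Prod.dist_eq]; exact le_max_left _ _) hfar
    have h2 : |p.2 - q.2| < zm := lt_of_le_of_lt (by rw [← Real.dist_eq, Prod.dist_eq]; exact le_max_right _ _) hfar
    have memsq : ∀ r : ℝ × ℝ, (klfl_wrap r.1, klfl_wrap r.2) ∈ Icc (-π) π ×ˢ Icc (-π) π := fun r =>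
      ⟨⟨(klfl_wrap_mem r.1).1, (klfl_wrap_mem r.1).2.le⟩, ⟨(klfl_wrap_mem r.2).1, (klfl_wrap_mem r.2).2.le⟩⟩
    rcases klfl_wrap_dichotomy hzmπ h1 with e1 | ⟨b1p, b1q⟩
    · rcases klfl_wrap_dichotomy hzmπ h2 with e2 | ⟨b2p, b2q⟩
      · -- coherent shifts: distance preserved
        have hdist : dist (klfl_wrap p.1, klfl_wrap p.2) (klfl_wrap q.1, klfl_wrap q.2) = dist p q := by
          rw [Prod.dist_eq, Prod.dist_eq, Real.dist_eq, Real.dist_eq, Real.dist_eq, Real.dist_eq, e1, e2]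
        calc ‖klfl_periodize g p - klfl_periodize g q‖ ≤ Lg * dist (klfl_wrap p.1, klfl_wrap p.2) (klfl_wrap q.1, klfl_wrap q.2) :=
            hlip _ (memsq p) _ (memsq q)
          _ = Lg * dist p q := by rw [hdist]
          _ ≤ (Lg + 2 * Mg / zm) * dist p q := by nlinarith [div_nonneg (mul_nonneg zero_le_two hMg) hzm.le]
      · rw [klfl_periodize, klfl_periodize, hg0 _ (Or.inr b2p), hg0 _ (Or.inr b2q), sub_self, norm_zero]; positivity
    · rw [klfl_periodize, klfl_periodize, hg0 _ (Or.inl b1p), hg0 _ (Or.inl b1q), sub_self, norm_zero]; positivity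

/-- **Continuity on the plane** from continuity of `g` (the periodization is locally `0` across the cell boundaries). -/
theorem klfl_periodize_continuous (hgc : Continuous g) (hzmπ : zm ≤ π) : Continuous (klfl_periodize g) := by
  rw [continuous_iff_continuousAt]
  intro p
  -- near a boundary line in either coordinate, `g_per` vanishes identically
  have hzero_fst : (∃ z : ℤ, p.1 = -π + z * (2 * π)) → klfl_periodize g =ᶠ[𝓝 p] fun _ => 0 := by
    intro hx
    have hU : {q : ℝ × ℝ | |q.1 - p.1| < zm} ∈ 𝓝 p := by
      have ho : IsOpen {q : ℝ × ℝ | |q.1 - p.1| < zm} :=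
        isOpen_lt (continuous_abs.comp (continuous_fst.sub continuous_const)) continuous_const
      exact ho.mem_nhds (by simp [hzm])
    refine Filter.eventually_of_mem hU fun q hq => ?_
    have hq' : |q.1 - p.1| < zm := hq
    have hb := klfl_abs_wrap_ge_of_modEq hx (lt_of_lt_of_le hq' hzmπ)
    rw [show p.1 + (q.1 - p.1) = q.1 by ring] at hb
    exact hg0 _ (Or.inl (by simp only; linarith))
  have hzero_snd : (∃ z : ℤ, p.2 = -π + z * (2 * π)) → klfl_periodize g =ᶠ[𝓝 p] fun _ => 0 := by
    intro hy
    have hU : {q : ℝ × ℝ | |q.2 - p.2| < zm} ∈ 𝓝 p := by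
      have ho : IsOpen {q : ℝ × ℝ | |q.2 - p.2| < zm} :=
        isOpen_lt (continuous_abs.comp (continuous_snd.sub continuous_const)) continuous_const
      exact ho.mem_nhds (by simp [hzm])
    refine Filter.eventually_of_mem hU fun q hq => ?_
    have hq' : |q.2 - p.2| < zm := hq
    have hb := klfl_abs_wrap_ge_of_modEq hy (lt_of_lt_of_le hq' hzmπ)
    rw [show p.2 + (q.2 - p.2) = q.2 by ring] at hb
    exact hg0 _ (Or.inr (by simp only; linarith))
  by_cases h1 : ∃ z : ℤ, p.1 = -π + z * (2 * π)
  · exact (continuousAt_const.congr (hzero_fst h1).symm)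
  by_cases h2 : ∃ z : ℤ, p.2 = -π + z * (2 * π)
  · exact (continuousAt_const.congr (hzero_snd h2).symm)
  -- away from the boundary lines the wrap is continuous in both coordinates
  have key : ∀ x : ℝ, x ≡ -π [PMOD (2 * π)] → ∃ z : ℤ, x = -π + z * (2 * π) := by
    intro x hmod
    have hw : klfl_wrap x = -π := (AddCommGroup.modEq_iff_toIcoMod_eq_left Real.two_pi_pos).mp (AddCommGroup.modEq_comm.mp hmod)
    obtain ⟨z, hz⟩ := klfl_wrap_sub_self x
    exact ⟨-z, by push_cast; linarith⟩
  have hm1 : ¬ p.1 ≡ -π [PMOD (2 * π)] := fun hmod => h1 (key p.1 hmod)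
  have hm2 : ¬ p.2 ≡ -π [PMOD (2 * π)] := fun hmod => h2 (key p.2 hmod)
  have hc1 : ContinuousAt (fun q : ℝ × ℝ => klfl_wrap q.1) p :=
    (continuousAt_toIcoMod Real.two_pi_pos (-π) hm1).comp continuousAt_fst
  have hc2 : ContinuousAt (fun q : ℝ × ℝ => klfl_wrap q.2) p :=
    (continuousAt_toIcoMod Real.two_pi_pos (-π) hm2).comp continuousAt_snd
  exact hgc.continuousAt.comp (hc1.prodMk hc2)

end BoundaryVanishing

end Summit.HubbardSuperconductivity.HubbardSuperconductivity.Theorems.KLRegimeSplit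

end
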